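/-
b2b-lace packet, CARVER gen 27 (unit `b2b-lace-carver-g27`).  DAG node D10H-2 / DIVERGENCE D80 option (B): the Step-1 `Ĥ₁`-cell
of [NoBLE17] §3.3.5 — the UNCHANGED printed cell `F3Bounds.boundH1 τ n l x r` — under a PER-KEY displayed table condition that no
longer requires the slot conditions (H-SC) `I_{m+3,j} ≤ d α̲_F IM[m,j]` / (H-low) `(ᾱ_F − 1) S_{m+3,j} ≤ 2d² IM[m,j]`: at every key
EITHER print's triple (H-IM) ∧ (H-SC) ∧ (H-low) OR the corrected majorisation (H-IM-D80)
`max (𝓙_{m+2,j}/α̲_F + (ᾱ_F − 1) I_{m+3,j}/(d α̲_F²)) ((ᾱ_F − 1) S_{m+3,j}/(2d² α̲_F²)) ≤ IM[m,j]`.  A drop-in generalisation of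
`NobleH1Step` / `NobleH1StepXSpace` (left disjunct everywhere = those theorems).  Additive: `F3Bounds`, `NobleH1SlotAlgebra`,
`NobleH1Step`, `NobleH1StepXSpace`, `NobleH1XSpace` and every record file untouched; d-generic; no dimension numeral, no named fact.
-/
import Literature.Probability.FitznerVanDerHofstad2017.NobleH1StepXSpace
import HarnessLib

/-!
# Literature.Probability.FitznerVanDerHofstad2017.NobleH1StepD80 — Step 1 of [NoBLE17] §3.3.5 under the per-key alternative table condition

[NoBLE17] = Fitzner–van der Hofstad, *Generalized approach to the non-backtracking lace expansion*, PTRF 169 (2017) 1041–1119;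
[NoBLE16] = the companion *Mean-field behavior for nearest-neighbor percolation in `d > 10`*, EJP 22 (2017), §3.3.5.

`NobleH1Step.abs_integral_H1_diagram_le_boundH1_zero/_one` bound the Step-1 piece `ℋ^{n,l}_1(x) = ∫ Ĥ₁ Ĝⁿ D̂^l D̂^{(x)} dP/(2π)^d`
(`n = 0, 1`) by the printed cell `F3Bounds.boundH1 τ n l x r` (`General.nb` `BoundH[1]`; slot coefficients `IM[m,j]/α̲_F^{m+1−ε}`).
To fold the `(α_F − 1)`-corrections of the two-sided x-space slot bounds

  (S1a) `X_{m+2,j}(x) ≤ 𝓙_{m+2,j}(x)/α_F^{m+2} + (α_F − 1) I_{m+3,j}(x)/(d α_F^{m+3})`,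
  (S1b) `−(α_F − 1) S_{m+3,j}(x)/(2d² α_F^{m+3}) ≤ X_{m+2,j}(x)`        (`X_{q,j}(x) = ∫ Ĉ*^q M̂* D̂^j D̂^{(x)}`, `S = srwIShift2`)

into the printed coefficient they display, at EVERY key `(m, j, y)`, the table conditions (H-IM) `𝓙_{m+2,j} ≤ IM[m,j]`, (H-SC) and
(H-low) (`H1Slot.upper_core` / `lower_core`; `H1Slot.printed_slot_iff`: (H-SC) is NECESSARY for that folding at `α_F = α̲_F` when
`IM = 𝓙`).

THIS MODULE observes that the envelope of (S1a)/(S1b) over `α_F ∈ [α̲_F, ᾱ_F]`, taken factor by factor, is itself of the printed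
shape: with `a = α̲_F`, `ā = ᾱ_F`,

  `|α_F^ε X_{m+2,j}(x)| ≤ IM′_{m,j}(x)/a^{m+1−ε}`,  `IM′_{m,j} := max (𝓙_{m+2,j}/a + (ā − 1) I_{m+3,j}/(d a²)) ((ā − 1) S_{m+3,j}/(2d² a²))`

(`H1SlotD80.env … 1 2`), with NO condition linking `I_{m+3,j}`, `S_{m+3,j}` to `IM`.  Hence the printed cell bounds `|ℋ^{n,l}_1(x)|` as
soon as, AT EACH KEY SEPARATELY, the table entry `IM[m,j,y]` satisfies the alternative

  `H1SlotD80.SlotAlt`:  ((H-IM) ∧ (H-SC) ∧ (H-low))  ∨  (H-IM-D80) `IM′_{m,j}(y) ≤ IM[m,j,y]`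

(`H1SlotD80.abs_slot_le`, `ε = 0`; `H1SlotD80.abs_alpha_mul_slot_le`, `ε = 1`; left disjunct = `H1Slot.abs_slot_le` /
`abs_alpha_mul_slot_le` verbatim).  The diagram theorems

* `abs_integral_H1_diagram_le_boundH1_zero_of_alt` / `_one_of_alt` (x-space bounds displayed as `hXup` / `hXlo`, as in `NobleH1Step`),
* `abs_integral_H1_diagram_le_boundH1_zero_of_alt_tables` / `_one_of_alt_tables` (x-space bounds discharged by `NobleH1XSpace`, as in
  `NobleH1StepXSpace`)

are the `NobleH1Step` / `NobleH1StepXSpace` theorems with the three hypotheses `hIM`, `hSC`, `hLow` replaced by the single per-key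
`hAlt`; conclusions LITERALLY the `hH1` binder of `abs_nobleH_le_boundHD75_of_pieces` (`≤ F3Bounds.boundH1 τ n l x r`), so the whole
existing cell chain consumes them unchanged — `F3Bounds.boundH1` is the only cell that reads the `IM` table.  The `m = −1` slot of
`n = 0` ((H-IM1), (H-low1)) and the (3.65)-remainder of `n = 1` ((H-T)) are exactly as in `NobleH1Step`.

Nothing here decides print-vs-code (packet DIVERGENCE D80): on a table where (H-SC) holds at every key the left disjunct is print's
reading; the right disjunct serves the keys where it does not, at the price of the larger entry `IM′` there.

Heartbeat census (packet filing rule, REFEREE ORDERS (2)): no `maxHeartbeats` option is set anywhere in this file; every declaration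
elaborates in a `set_option maxHeartbeats 50000 in` capped twin (pre-filing farm check, rc 0); the two long proofs are line-by-line
copies of the `NobleH1Step` proofs with the two slot lemmas exchanged.
-/

noncomputable section

open MeasureTheory Real
open Literature.Barriers.CriticalPhenomena
open Literature.Barriers.CriticalPhenomena.Slade2006Prop53 (P)
open Literature.Probability.LatticeModels

namespace Literature.Probability.FitznerVanDerHofstad2017

/-! ## Slot algebra under the per-key alternative -/

namespace H1SlotD80

/-- The D80 slot envelope `max (IM/a^{q₁} + (ā − 1) I/(d a^{q₂})) ((ā − 1) S/(2d² a^{q₂}))` (`a = α̲_F`, `ā = ᾱ_F`, `d = dR`);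
at `(q₁, q₂) = (1, 2)` and `IM = 𝓙_{m+2,j}` it is the corrected majorant `IM′_{m,j}` of the module docstring.
[cite: FitznerVanDerHofstad2016NoBLE, §3.3.5 (3.61)–(3.62) p. 1076] -/
def env (dR IM I S a amax : ℝ) (q₁ q₂ : ℕ) : ℝ :=
  max (IM / a ^ q₁ + (amax - 1) * I / (dR * a ^ q₂)) ((amax - 1) * S / (2 * dR ^ 2 * a ^ q₂))

/-- **The per-key alternative table condition** for a slot key `(m, j, y)` with true values `J = 𝓙_{m+2,j}(y)`, `I = I_{m+3,j}(y)`,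
`S = S_{m+3,j}(y)` and table entry `IM = IM[m,j,y]`: EITHER print's triple (H-IM) `J ≤ IM`, (H-SC) `I ≤ d·a·IM`, (H-low)
`(ā − 1)·S ≤ 2d²·IM`, OR the corrected majorisation (H-IM-D80) `max (J/a + (ā−1) I/(d a²)) ((ā−1) S/(2d² a²)) ≤ IM`.
[cite: FitznerVanDerHofstad2016NoBLE, §3.3.5 (3.61)–(3.62), (3.64) p. 1076] -/
def SlotAlt (dR a amax J I S IM : ℝ) : Prop :=
  (J ≤ IM ∧ I ≤ dR * a * IM ∧ (amax - 1) * S ≤ 2 * dR ^ 2 * IM) ∨ env dR J I S a amax 1 2 ≤ IM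

/-- The upper branch of the corrected slot bound (3.61)/(S1a), `𝓙/α^{q₁} + (α−1) I/(d α^{q₂})`, is dominated factor by factor
over `α ∈ [a, ā]`, `𝓙 ≤ IM`, `I ≤ Ib` by `IM/a^{q₁} + (ā−1) Ib/(d a^{q₂})`. [cite: FitznerVanDerHofstad2016NoBLE, §3.3.5 (3.61)–(3.62) p. 1076] -/
theorem upper_le {dR a α amax J I IM Ib : ℝ} (q₁ q₂ : ℕ) (hd : 0 < dR) (ha1 : 1 ≤ a) (haα : a ≤ α)
    (hαmax : α ≤ amax) (hIM0 : 0 ≤ IM) (hJ : J ≤ IM) (hI0 : 0 ≤ I) (hIb : I ≤ Ib) :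
    J / α ^ q₁ + (α - 1) * I / (dR * α ^ q₂) ≤ IM / a ^ q₁ + (amax - 1) * Ib / (dR * a ^ q₂) := by
  have ha0 : 0 < a := by linarith
  have hα0 : 0 < α := by linarith
  have h1 : J / α ^ q₁ ≤ IM / α ^ q₁ := div_le_div_of_nonneg_right hJ (by positivity)
  have h2 : IM / α ^ q₁ ≤ IM / a ^ q₁ := H1Slot.div_pow_le_div_pow q₁ ha0 haα hIM0
  have h3 : (α - 1) * I ≤ (amax - 1) * Ib := mul_le_mul (by linarith) hIb hI0 (by linarith)
  have h4 : (α - 1) * I / (dR * α ^ q₂) ≤ (amax - 1) * Ib / (dR * α ^ q₂) :=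
    div_le_div_of_nonneg_right h3 (by positivity)
  have h5 : (amax - 1) * Ib / (dR * α ^ q₂) ≤ (amax - 1) * Ib / (dR * a ^ q₂) :=
    div_le_div_of_nonneg_left (mul_nonneg (by linarith) (hI0.trans hIb)) (by positivity)
      (mul_le_mul_of_nonneg_left (pow_le_pow_left₀ ha0.le haα q₂) hd.le)
  linarith

/-- The magnitude of the lower branch of the corrected slot bound (3.62)/(S1b), `(α−1) S/(2d² α^{q₂})`, is dominated factor by
factor over `α ∈ [a, ā]`, `S ≤ Sb` by `(ā−1) Sb/(2d² a^{q₂})`. [cite: FitznerVanDerHofstad2016NoBLE, §3.3.5 (3.61)–(3.62) p. 1076] -/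
theorem lower_le {dR a α amax S Sb : ℝ} (q₂ : ℕ) (hd : 0 < dR) (ha1 : 1 ≤ a) (haα : a ≤ α) (hαmax : α ≤ amax)
    (hS0 : 0 ≤ S) (hSb : S ≤ Sb) :
    (α - 1) * S / (2 * dR ^ 2 * α ^ q₂) ≤ (amax - 1) * Sb / (2 * dR ^ 2 * a ^ q₂) := by
  have ha0 : 0 < a := by linarith
  have hα0 : 0 < α := by linarith
  have h3 : (α - 1) * S ≤ (amax - 1) * Sb := mul_le_mul (by linarith) hSb hS0 (by linarith)
  have h4 : (α - 1) * S / (2 * dR ^ 2 * α ^ q₂) ≤ (amax - 1) * Sb / (2 * dR ^ 2 * α ^ q₂) :=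
    div_le_div_of_nonneg_right h3 (by positivity)
  have h5 : (amax - 1) * Sb / (2 * dR ^ 2 * α ^ q₂) ≤ (amax - 1) * Sb / (2 * dR ^ 2 * a ^ q₂) :=
    div_le_div_of_nonneg_left (mul_nonneg (by linarith) (hS0.trans hSb)) (by positivity)
      (mul_le_mul_of_nonneg_left (pow_le_pow_left₀ ha0.le haα q₂) (by positivity))
  linarith

/-- (H-IM-D80) shifted to the `ε = 0` exponents: both branches at `(m+2, m+3)` are `≤ IM/a^{m+1}`. [cite: FitznerVanDerHofstad2016NoBLE, §3.3.5 (3.61)–(3.62) p. 1076] -/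
theorem branches_le_zero {dR J I S a amax IM : ℝ} (m : ℕ) (ha : 0 < a) (hd : 0 < dR)
    (hIMD : env dR J I S a amax 1 2 ≤ IM) :
    J / a ^ (m + 2) + (amax - 1) * I / (dR * a ^ (m + 3)) ≤ IM / a ^ (m + 1) ∧
      (amax - 1) * S / (2 * dR ^ 2 * a ^ (m + 3)) ≤ IM / a ^ (m + 1) := by
  unfold env at hIMD
  have h1 : J / a ^ 1 + (amax - 1) * I / (dR * a ^ 2) ≤ IM := (le_max_left _ _).trans hIMD
  have h2 : (amax - 1) * S / (2 * dR ^ 2 * a ^ 2) ≤ IM := (le_max_right _ _).trans hIMD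
  have hak : 0 < a ^ (m + 1) := pow_pos ha (m + 1)
  constructor
  · have e : J / a ^ (m + 2) + (amax - 1) * I / (dR * a ^ (m + 3))
        = (J / a ^ 1 + (amax - 1) * I / (dR * a ^ 2)) / a ^ (m + 1) := by
      field_simp
      ring
    rw [e]
    exact div_le_div_of_nonneg_right h1 hak.le
  · have e : (amax - 1) * S / (2 * dR ^ 2 * a ^ (m + 3)) = ((amax - 1) * S / (2 * dR ^ 2 * a ^ 2)) / a ^ (m + 1) := by
      field_simp
      ring
    rw [e]
    exact div_le_div_of_nonneg_right h2 hak.le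

/-- (H-IM-D80) shifted to the `ε = 1` exponents: both branches at `(m+1, m+2)` are `≤ IM/a^{m}`. [cite: FitznerVanDerHofstad2016NoBLE, §3.3.5 (3.61)–(3.62) p. 1076] -/
theorem branches_le_one {dR J I S a amax IM : ℝ} (m : ℕ) (ha : 0 < a) (hd : 0 < dR)
    (hIMD : env dR J I S a amax 1 2 ≤ IM) :
    J / a ^ (m + 1) + (amax - 1) * I / (dR * a ^ (m + 2)) ≤ IM / a ^ m ∧
      (amax - 1) * S / (2 * dR ^ 2 * a ^ (m + 2)) ≤ IM / a ^ m := by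
  unfold env at hIMD
  have h1 : J / a ^ 1 + (amax - 1) * I / (dR * a ^ 2) ≤ IM := (le_max_left _ _).trans hIMD
  have h2 : (amax - 1) * S / (2 * dR ^ 2 * a ^ 2) ≤ IM := (le_max_right _ _).trans hIMD
  have hak : 0 < a ^ m := pow_pos ha m
  constructor
  · have e : J / a ^ (m + 1) + (amax - 1) * I / (dR * a ^ (m + 2))
        = (J / a ^ 1 + (amax - 1) * I / (dR * a ^ 2)) / a ^ m := by
      field_simp
      ring
    rw [e]
    exact div_le_div_of_nonneg_right h1 hak.le
  · have e : (amax - 1) * S / (2 * dR ^ 2 * a ^ (m + 2)) = ((amax - 1) * S / (2 * dR ^ 2 * a ^ 2)) / a ^ m := by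
      field_simp
      ring
    rw [e]
    exact div_le_div_of_nonneg_right h2 hak.le

/-- **Slot lemma under the per-key alternative, `ε = 0`** (the `Ĉ*²M̂*` group of the `n = 1` cell): from the two-sided corrected
bounds `hX` (S1a) / `hX'` (S1b) at the true `α_F = α ∈ [a, ā]`, `𝓙, I, S ≥ 0` and `SlotAlt`, the PRINTED slot `IM/a^{m+1}` dominates
`|X_{m+2,j}|`.  Left disjunct = `H1Slot.abs_slot_le`.
[cite: FitznerVanDerHofstad2016NoBLE, §3.3.5 (3.61)–(3.62), (3.64) p. 1076; FitznerVanDerHofstad2017, notebook General.nb In[2]] -/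
theorem abs_slot_le {dR a α amax J I S IM X : ℝ} (m : ℕ) (hd : 0 < dR) (ha1 : 1 ≤ a) (haα : a ≤ α)
    (hαmax : α ≤ amax) (hJ0 : 0 ≤ J) (hI0 : 0 ≤ I) (hS0 : 0 ≤ S) (hAlt : SlotAlt dR a amax J I S IM)
    (hX : X ≤ J / α ^ (m + 2) + (α - 1) * I / (dR * α ^ (m + 3)))
    (hX' : -((α - 1) * S / (2 * dR ^ 2 * α ^ (m + 3))) ≤ X) :
    |X| ≤ IM / a ^ (m + 1) := by
  rcases hAlt with ⟨hJ, hSC, hlow⟩ | hIMD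
  · exact H1Slot.abs_slot_le m hd ha1 haα hαmax (hJ0.trans hJ) hJ hS0 hSC hlow hX hX'
  · have ha0 : 0 < a := by linarith
    obtain ⟨hb1, hb2⟩ := branches_le_zero m ha0 hd hIMD
    have hup : X ≤ J / a ^ (m + 2) + (amax - 1) * I / (dR * a ^ (m + 3)) :=
      hX.trans (upper_le (m + 2) (m + 3) hd ha1 haα hαmax hJ0 le_rfl hI0 le_rfl)
    have hlo := lower_le (m + 3) hd ha1 haα hαmax hS0 (le_refl S)
    exact abs_le.mpr ⟨by linarith, by linarith⟩

/-- **Slot lemma under the per-key alternative, `ε = 1`** (the slots whose (3.52)-coefficient carries one `α_F`): the PRINTED slot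
`IM/a^{m}` dominates `|α_F X_{m+2,j}|`.  Left disjunct = `H1Slot.abs_alpha_mul_slot_le`.
[cite: FitznerVanDerHofstad2016NoBLE, §3.3.5 (3.61)–(3.62), (3.64) p. 1076; FitznerVanDerHofstad2017, notebook General.nb In[2]] -/
theorem abs_alpha_mul_slot_le {dR a α amax J I S IM X : ℝ} (m : ℕ) (hd : 0 < dR) (ha1 : 1 ≤ a) (haα : a ≤ α)
    (hαmax : α ≤ amax) (hJ0 : 0 ≤ J) (hI0 : 0 ≤ I) (hS0 : 0 ≤ S) (hAlt : SlotAlt dR a amax J I S IM)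
    (hX : X ≤ J / α ^ (m + 2) + (α - 1) * I / (dR * α ^ (m + 3)))
    (hX' : -((α - 1) * S / (2 * dR ^ 2 * α ^ (m + 3))) ≤ X) :
    |α * X| ≤ IM / a ^ m := by
  rcases hAlt with ⟨hJ, hSC, hlow⟩ | hIMD
  · exact H1Slot.abs_alpha_mul_slot_le m hd ha1 haα hαmax (hJ0.trans hJ) hJ hS0 hSC hlow hX hX'
  · have ha0 : 0 < a := by linarith
    have hα0 : 0 < α := by linarith
    obtain ⟨hb1, hb2⟩ := branches_le_one m ha0 hd hIMD
    have hup0 : α * X ≤ α * (J / α ^ (m + 2) + (α - 1) * I / (dR * α ^ (m + 3))) :=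
      mul_le_mul_of_nonneg_left hX hα0.le
    have e1 : α * (J / α ^ (m + 2) + (α - 1) * I / (dR * α ^ (m + 3)))
        = J / α ^ (m + 1) + (α - 1) * I / (dR * α ^ (m + 2)) := by
      field_simp
      ring
    rw [e1] at hup0
    have hup : α * X ≤ J / a ^ (m + 1) + (amax - 1) * I / (dR * a ^ (m + 2)) :=
      hup0.trans (upper_le (m + 1) (m + 2) hd ha1 haα hαmax hJ0 le_rfl hI0 le_rfl)
    have hlo0 : α * -((α - 1) * S / (2 * dR ^ 2 * α ^ (m + 3))) ≤ α * X := mul_le_mul_of_nonneg_left hX' hα0.le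
    have e2 : α * -((α - 1) * S / (2 * dR ^ 2 * α ^ (m + 3))) = -((α - 1) * S / (2 * dR ^ 2 * α ^ (m + 2))) := by
      field_simp
      ring
    rw [e2] at hlo0
    have hlo := lower_le (m + 2) hd ha1 haα hαmax hS0 (le_refl S)
    exact abs_le.mpr ⟨by linarith, by linarith⟩

/-- Print's triple (H-IM) ∧ (H-SC) ∧ (H-low) is the left disjunct of `SlotAlt`. [cite: FitznerVanDerHofstad2016NoBLE, §3.3.5 (3.62) p. 1076] -/
theorem slotAlt_of_printed {dR a amax J I S IM : ℝ} (hJ : J ≤ IM) (hSC : I ≤ dR * a * IM)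
    (hlow : (amax - 1) * S ≤ 2 * dR ^ 2 * IM) : SlotAlt dR a amax J I S IM :=
  Or.inl ⟨hJ, hSC, hlow⟩

/-- The corrected majorisation (H-IM-D80) is the right disjunct of `SlotAlt`. [cite: FitznerVanDerHofstad2016NoBLE, §3.3.5 (3.61)–(3.62) p. 1076] -/
theorem slotAlt_of_env_le {dR a amax J I S IM : ℝ} (h : env dR J I S a amax 1 2 ≤ IM) : SlotAlt dR a amax J I S IM :=
  Or.inr h

end H1SlotD80

/-! ## The two diagram theorems -/

section StepOneD80

variable {d : ℕ} {cΦ αΦ cF αF : ℝ} {RΦ RF : Site d → ℝ} {r : F3Bounds.Args}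

/-- **[NoBLE17] §3.3.5 Step 1, `n = 0`, Tables form under the per-key alternative** ((3.58)–(3.63), (3.71); `General.nb` `BoundH[1]`
at `n = 0`): for `2·3+1 ≤ d`, atoms with `KeyBounds r` on the cube off `{D̂ = 1}`, the strict window, `1 ≤ α̲_F`, the two-sided x-space
bounds of the `m = 0` slot (`hXup`, `hXlo`) and a table `τ` with, at every key `(0, j, y)`, `SlotAlt` (print's (H-IM) ∧ (H-SC) ∧ (H-low)
OR (H-IM-D80)), and `I_{1,j+1} + S_{2,j}/(2d² α̲_F) ≤ IM[−1,j]`, `I_{2,j} ≤ d α̲_F IM[−1,j]`: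
`|∫ Ĥ₁ Ĝ⁰ D̂^l D̂^{(x)} dP/(2π)^d| ≤ c̄_Φ IM[0,l] + β_{α,Φ} IM[0,l+1] + (β_{α,Φ}/α̲_F) IM[−1,l] = F3Bounds.boundH1 τ 0 l x r`.
`NobleH1Step.abs_integral_H1_diagram_le_boundH1_zero` is the case "left disjunct at every key".
[cite: FitznerVanDerHofstad2016NoBLE, §3.3.5 (3.58)–(3.63), (3.71) pp. 1074–1077; FitznerVanDerHofstad2017, notebook General.nb In[2] BoundH[1]] -/
theorem abs_integral_H1_diagram_le_boundH1_zero_of_alt (hd : 2 * 3 + 1 ≤ d)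
    (hKB : ∀ k ∈ cube d, Dhat d k < 1 → (lapAtomsAt d cΦ αΦ cF αF RΦ RF k).KeyBounds r)
    (hc0 : cF + αF + cosFT RF 0 < 1) (hα1 : 1 ≤ r.afmin) (τ : F3Bounds.Tables (Fin d → ℤ))
    (hXup : ∀ j y, (∫ k, (lapAtomsAt d cΦ αΦ cF αF RΦ RF k).Cstar ^ 2 * (lapAtomsAt d cΦ αΦ cF αF RΦ RF k).Mstar *
        (Dhat d k ^ j * DhatSym d y k) ∂P d) / (2 * π) ^ d
      ≤ srwJ d 2 j y / αF ^ 2 + (αF - 1) * srwI d 3 j y / (d * αF ^ 3))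
    (hXlo : ∀ j y, -((αF - 1) * srwIShift2 d 3 j y / (2 * (d : ℝ) ^ 2 * αF ^ 3))
      ≤ (∫ k, (lapAtomsAt d cΦ αΦ cF αF RΦ RF k).Cstar ^ 2 * (lapAtomsAt d cΦ αΦ cF αF RΦ RF k).Mstar *
        (Dhat d k ^ j * DhatSym d y k) ∂P d) / (2 * π) ^ d)
    (hAlt : ∀ j y, H1SlotD80.SlotAlt d r.afmin r.afmax (srwJ d 2 j y) (srwI d 3 j y) (srwIShift2 d 3 j y) (τ.IM 0 j y))
    (hIM1 : ∀ j y, srwI d 1 (j + 1) y + srwIShift2 d 2 j y / (2 * (d : ℝ) ^ 2 * r.afmin) ≤ τ.IM (-1) j y)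
    (hLow1 : ∀ j y, srwI d 2 j y ≤ d * r.afmin * τ.IM (-1) j y) (l : ℕ) (x : Fin d → ℤ) :
    |(∫ k, (lapAtomsAt d cΦ αΦ cF αF RΦ RF k).H1 * (lapAtomsAt d cΦ αΦ cF αF RΦ RF k).G ^ 0 *
        Dhat d k ^ l * DhatSym d x k ∂P d) / (2 * π) ^ d| ≤ F3Bounds.boundH1 τ 0 l x r := by
  obtain ⟨hαF, hαFup, hcΦ0, hcΦ, hαΦ, -⟩ := keyBounds_consts (by omega) hKB
  have hα : 1 ≤ αF := hα1.trans hαF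
  have hd0 : (0 : ℝ) < d := by exact_mod_cast (show 0 < d by omega)
  have hcp : 0 ≤ r.cp := hcΦ0.trans hcΦ
  have hap : 0 ≤ r.ap := (abs_nonneg _).trans hαΦ
  have hI : ∀ q j, Integrable (fun k => (lapAtomsAt d cΦ αΦ cF αF RΦ RF k).Cstar ^ q *
      (lapAtomsAt d cΦ αΦ cF αF RΦ RF k).Mstar * (Dhat d k ^ j * DhatSym d x k)) (P d) :=
    fun q j => integrable_Cstar_pow_Mstar_weight hc0 (by linarith) q j x
  -- the three slot integrands
  set f1 : (Fin d → ℝ) → ℝ := fun k => (lapAtomsAt d cΦ αΦ cF αF RΦ RF k).Cstar ^ 2 *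
    (lapAtomsAt d cΦ αΦ cF αF RΦ RF k).Mstar * (Dhat d k ^ l * DhatSym d x k) with hf1
  set f2 : (Fin d → ℝ) → ℝ := fun k => (lapAtomsAt d cΦ αΦ cF αF RΦ RF k).Cstar ^ 2 *
    (lapAtomsAt d cΦ αΦ cF αF RΦ RF k).Mstar * (Dhat d k ^ (l + 1) * DhatSym d x k) with hf2
  set f3 : (Fin d → ℝ) → ℝ := fun k => (lapAtomsAt d cΦ αΦ cF αF RΦ RF k).Cstar *
    (lapAtomsAt d cΦ αΦ cF αF RΦ RF k).Mstar * (Dhat d k ^ l * DhatSym d x k) with hf3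
  have hf1i : Integrable f1 (P d) := hI 2 l
  have hf2i : Integrable f2 (P d) := hI 2 (l + 1)
  have hf3i : Integrable f3 (P d) := by
    have h := hI 1 l
    simp only [pow_one] at h
    exact h
  -- the (3.52)/(3.59) expansion at `n = 0`, pointwise and integrated
  have hpt : ∀ k, (lapAtomsAt d cΦ αΦ cF αF RΦ RF k).H1 * (lapAtomsAt d cΦ αΦ cF αF RΦ RF k).G ^ 0 *
      Dhat d k ^ l * DhatSym d x k = cΦ * αF * f1 k + αΦ * αF * f2 k + αΦ * f3 k := by
    intro k
    simp only [hf1, hf2, hf3, LapAtoms.H1, lapAtomsAt_αF, lapAtomsAt_cΦ, lapAtomsAt_αΦ, lapAtomsAt_D]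
    ring
  have hsplit : (∫ k, (lapAtomsAt d cΦ αΦ cF αF RΦ RF k).H1 * (lapAtomsAt d cΦ αΦ cF αF RΦ RF k).G ^ 0 *
        Dhat d k ^ l * DhatSym d x k ∂P d) / (2 * π) ^ d
      = cΦ * αF * ((∫ k, f1 k ∂P d) / (2 * π) ^ d) + αΦ * αF * ((∫ k, f2 k ∂P d) / (2 * π) ^ d)
        + αΦ * ((∫ k, f3 k ∂P d) / (2 * π) ^ d) := by
    rw [integral_congr_ae (ae_of_all _ hpt)]
    exact integral_div_three_terms _ _ _ hf1i hf2i hf3i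
  -- the three slot bounds
  have b1 : |αF * ((∫ k, f1 k ∂P d) / (2 * π) ^ d)| ≤ τ.IM 0 l x := by
    have h := H1SlotD80.abs_alpha_mul_slot_le (dR := (d : ℝ)) 0 hd0 hα1 hαF hαFup (srwJ_nonneg (n := 0) (by omega) l x)
      (srwI_nonneg 3 (by omega) l x) (srwIShift2_nonneg (p := 3) (by omega) l x) (hAlt l x) (hXup l x) (hXlo l x)
    simp only [pow_zero, div_one] at h
    exact h
  have b2 : |αF * ((∫ k, f2 k ∂P d) / (2 * π) ^ d)| ≤ τ.IM 0 (l + 1) x := by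
    have h := H1SlotD80.abs_alpha_mul_slot_le (dR := (d : ℝ)) 0 hd0 hα1 hαF hαFup
      (srwJ_nonneg (n := 0) (by omega) (l + 1) x) (srwI_nonneg 3 (by omega) (l + 1) x)
      (srwIShift2_nonneg (p := 3) (by omega) (l + 1) x) (hAlt (l + 1) x) (hXup (l + 1) x) (hXlo (l + 1) x)
    simp only [pow_zero, div_one] at h
    exact h
  have b3 : |(∫ k, f3 k ∂P d) / (2 * π) ^ d| ≤ τ.IM (-1) l x / r.afmin :=
    H1Slot.abs_m1_slot_le (dR := (d : ℝ)) hd0 hα1 hαF (srwI_nonneg 1 (by omega) (l + 1) x)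
      (srwIShift2_nonneg (p := 2) (by omega) l x) (hIM1 l x) (hLow1 l x)
      (integral_Cstar_Mstar_le (cΦ := cΦ) (αΦ := αΦ) (RΦ := RΦ) (by omega) hc0 hα l x)
      (neg_le_integral_Cstar_Mstar (cΦ := cΦ) (αΦ := αΦ) (RΦ := RΦ) (by omega) hc0 hα l x)
  -- assemble
  have hbd0 : F3Bounds.boundH1 τ 0 l x r
      = r.cp * τ.IM 0 l x + r.ap * τ.IM 0 (l + 1) x + r.ap / r.afmin * τ.IM (-1) l x := rfl
  rw [hsplit]
  have e : cΦ * αF * ((∫ k, f1 k ∂P d) / (2 * π) ^ d) + αΦ * αF * ((∫ k, f2 k ∂P d) / (2 * π) ^ d)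
        + αΦ * ((∫ k, f3 k ∂P d) / (2 * π) ^ d)
      = cΦ * (αF * ((∫ k, f1 k ∂P d) / (2 * π) ^ d)) + αΦ * (αF * ((∫ k, f2 k ∂P d) / (2 * π) ^ d))
        + αΦ * ((∫ k, f3 k ∂P d) / (2 * π) ^ d) := by ring
  rw [e]
  have i1 : |cΦ * (αF * ((∫ k, f1 k ∂P d) / (2 * π) ^ d))| ≤ r.cp * τ.IM 0 l x := by
    rw [abs_mul, abs_of_nonneg hcΦ0]; exact mul_le_mul hcΦ b1 (abs_nonneg _) hcp
  have i2 : |αΦ * (αF * ((∫ k, f2 k ∂P d) / (2 * π) ^ d))| ≤ r.ap * τ.IM 0 (l + 1) x := by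
    rw [abs_mul]; exact mul_le_mul hαΦ b2 (abs_nonneg _) hap
  have i3 : |αΦ * ((∫ k, f3 k ∂P d) / (2 * π) ^ d)| ≤ r.ap * (τ.IM (-1) l x / r.afmin) := by
    rw [abs_mul]; exact mul_le_mul hαΦ b3 (abs_nonneg _) hap
  calc _ ≤ |cΦ * (αF * ((∫ k, f1 k ∂P d) / (2 * π) ^ d))| + |αΦ * (αF * ((∫ k, f2 k ∂P d) / (2 * π) ^ d))|
        + |αΦ * ((∫ k, f3 k ∂P d) / (2 * π) ^ d)| := abs_add_three _ _ _
    _ ≤ r.cp * τ.IM 0 l x + r.ap * τ.IM 0 (l + 1) x + r.ap * (τ.IM (-1) l x / r.afmin) := add_le_add_three i1 i2 i3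
    _ = F3Bounds.boundH1 τ 0 l x r := by rw [hbd0]; ring

/-- **[NoBLE17] §3.3.5 Step 1, `n = 1`, Tables form under the per-key alternative** ((3.58)–(3.66), (3.71); `General.nb` `BoundH[1]`
at `n = 1`): for `2·4+1 ≤ d`, atoms with `KeyBounds r` on the cube off `{D̂ = 1}`, the strict window, `1 ≤ α̲_F`, the two-sided x-space
bounds of the `m = 0, 1` slots (`hXup`, `hXlo`), a table `τ` with `SlotAlt` at every key `(m, j, y)`, `m ≤ 1` (print's (H-IM) ∧ (H-SC) ∧
(H-low) OR (H-IM-D80)) and `TS_{m,j} ≤ T[m,j]` (`srwTS` of `NobleH2Step`); `NobleH1Step.abs_integral_H1_diagram_le_boundH1_one` is the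
case "left disjunct at every key":
`|∫ Ĥ₁ Ĝ¹ D̂^l D̂^{(x)} dP/(2π)^d| ≤ c̄_Φ²/α̲_F IM[1,l] + c̄_Φβ_{α,Φ}/α̲_F IM[0,l] + 2(β_{α,Φ}c̄_Φ/α̲_F) IM[1,l+1] + β_{α,Φ}²/α̲_F IM[0,l+1]
+ β_{α,Φ}²/α̲_F IM[1,l+2] + (β_{R,Φ} + β_{ΔR,F}Γ₂′)/α̲_F² (c̄_Φ T[3,l] + β_{α,Φ} T[3,l+1] + β_{α,Φ} T[2,l]) = F3Bounds.boundH1 τ 1 l x r`.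
(If the signed integrand is not integrable the left side is `0` by convention and the bound holds trivially; the integrable case is the
content.)
[cite: FitznerVanDerHofstad2016NoBLE, §3.3.5 (3.58)–(3.66), (3.71) pp. 1074–1077; FitznerVanDerHofstad2017, notebook General.nb In[2] BoundH[1]] -/
theorem abs_integral_H1_diagram_le_boundH1_one_of_alt (hd : 2 * 4 + 1 ≤ d)
    (hKB : ∀ k ∈ cube d, Dhat d k < 1 → (lapAtomsAt d cΦ αΦ cF αF RΦ RF k).KeyBounds r)
    (hc0 : cF + αF + cosFT RF 0 < 1) (hα1 : 1 ≤ r.afmin) (τ : F3Bounds.Tables (Fin d → ℤ))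
    (hXup : ∀ (m j : ℕ) (y : Fin d → ℤ), m ≤ 1 →
      (∫ k, (lapAtomsAt d cΦ αΦ cF αF RΦ RF k).Cstar ^ (m + 2) * (lapAtomsAt d cΦ αΦ cF αF RΦ RF k).Mstar *
          (Dhat d k ^ j * DhatSym d y k) ∂P d) / (2 * π) ^ d
        ≤ srwJ d (m + 2) j y / αF ^ (m + 2) + (αF - 1) * srwI d (m + 3) j y / (d * αF ^ (m + 3)))
    (hXlo : ∀ (m j : ℕ) (y : Fin d → ℤ), m ≤ 1 → -((αF - 1) * srwIShift2 d (m + 3) j y / (2 * (d : ℝ) ^ 2 * αF ^ (m + 3)))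
        ≤ (∫ k, (lapAtomsAt d cΦ αΦ cF αF RΦ RF k).Cstar ^ (m + 2) * (lapAtomsAt d cΦ αΦ cF αF RΦ RF k).Mstar *
          (Dhat d k ^ j * DhatSym d y k) ∂P d) / (2 * π) ^ d)
    (hAlt : ∀ (m j : ℕ) (y : Fin d → ℤ), m ≤ 1 → H1SlotD80.SlotAlt d r.afmin r.afmax (srwJ d (m + 2) j y)
      (srwI d (m + 3) j y) (srwIShift2 d (m + 3) j y) (τ.IM m j y))
    (hT : ∀ (m j : ℕ) (y : Fin d → ℤ), srwTS d r.afmin m j y ≤ τ.T m j y) (l : ℕ) (x : Fin d → ℤ) :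
    |(∫ k, (lapAtomsAt d cΦ αΦ cF αF RΦ RF k).H1 * (lapAtomsAt d cΦ αΦ cF αF RΦ RF k).G ^ 1 *
        Dhat d k ^ l * DhatSym d x k ∂P d) / (2 * π) ^ d| ≤ F3Bounds.boundH1 τ 1 l x r := by
  obtain ⟨hαF, hαFup, hcΦ0, hcΦ, hαΦ, hβ⟩ := keyBounds_consts (by omega) hKB
  have hα : 1 ≤ αF := hα1.trans hαF
  have hd0 : (0 : ℝ) < d := by exact_mod_cast (show 0 < d by omega)
  have hcp : 0 ≤ r.cp := hcΦ0.trans hcΦ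
  have hap : 0 ≤ r.ap := (abs_nonneg _).trans hαΦ
  have hI : ∀ q j, Integrable (fun k => (lapAtomsAt d cΦ αΦ cF αF RΦ RF k).Cstar ^ q *
      (lapAtomsAt d cΦ αΦ cF αF RΦ RF k).Mstar * (Dhat d k ^ j * DhatSym d x k)) (P d) :=
    fun q j => integrable_Cstar_pow_Mstar_weight hc0 (by linarith) q j x
  -- the five slot integrands and the (3.65)-remainder
  set f1 : (Fin d → ℝ) → ℝ := fun k => (lapAtomsAt d cΦ αΦ cF αF RΦ RF k).Cstar ^ 3 *
    (lapAtomsAt d cΦ αΦ cF αF RΦ RF k).Mstar * (Dhat d k ^ l * DhatSym d x k) with hf1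
  set f2 : (Fin d → ℝ) → ℝ := fun k => (lapAtomsAt d cΦ αΦ cF αF RΦ RF k).Cstar ^ 3 *
    (lapAtomsAt d cΦ αΦ cF αF RΦ RF k).Mstar * (Dhat d k ^ (l + 1) * DhatSym d x k) with hf2
  set f3 : (Fin d → ℝ) → ℝ := fun k => (lapAtomsAt d cΦ αΦ cF αF RΦ RF k).Cstar ^ 3 *
    (lapAtomsAt d cΦ αΦ cF αF RΦ RF k).Mstar * (Dhat d k ^ (l + 2) * DhatSym d x k) with hf3
  set f4 : (Fin d → ℝ) → ℝ := fun k => (lapAtomsAt d cΦ αΦ cF αF RΦ RF k).Cstar ^ 2 *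
    (lapAtomsAt d cΦ αΦ cF αF RΦ RF k).Mstar * (Dhat d k ^ l * DhatSym d x k) with hf4
  set f5 : (Fin d → ℝ) → ℝ := fun k => (lapAtomsAt d cΦ αΦ cF αF RΦ RF k).Cstar ^ 2 *
    (lapAtomsAt d cΦ αΦ cF αF RΦ RF k).Mstar * (Dhat d k ^ (l + 1) * DhatSym d x k) with hf5
  set R : (Fin d → ℝ) → ℝ := fun k => (lapAtomsAt d cΦ αΦ cF αF RΦ RF k).H1 *
    (((lapAtomsAt d cΦ αΦ cF αF RΦ RF k).RΦ - (lapAtomsAt d cΦ αΦ cF αF RΦ RF k).δRF *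
        (lapAtomsAt d cΦ αΦ cF αF RΦ RF k).G) * (lapAtomsAt d cΦ αΦ cF αF RΦ RF k).Cstar) *
      (Dhat d k ^ l * DhatSym d x k) with hR
  have hf1i : Integrable f1 (P d) := hI 3 l
  have hf2i : Integrable f2 (P d) := hI 3 (l + 1)
  have hf3i : Integrable f3 (P d) := hI 3 (l + 2)
  have hf4i : Integrable f4 (P d) := hI 2 l
  have hf5i : Integrable f5 (P d) := hI 2 (l + 1)
  have hmainI : Integrable (fun k => cΦ ^ 2 * αF * f1 k + 2 * (cΦ * αΦ) * αF * f2 k + αΦ ^ 2 * αF * f3 k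
      + αΦ * cΦ * f4 k + αΦ ^ 2 * f5 k) (P d) :=
    ((((hf1i.const_mul _).add (hf2i.const_mul _)).add (hf3i.const_mul _)).add (hf4i.const_mul _)).add
      (hf5i.const_mul _)
  -- the (3.64) expansion at `n = 1`, a.e. on the cube (off `{D̂ = 1}`)
  have hae : ∀ᵐ k ∂P d, (lapAtomsAt d cΦ αΦ cF αF RΦ RF k).H1 * (lapAtomsAt d cΦ αΦ cF αF RΦ RF k).G ^ 1 *
      Dhat d k ^ l * DhatSym d x k
      = (cΦ ^ 2 * αF * f1 k + 2 * (cΦ * αΦ) * αF * f2 k + αΦ ^ 2 * αF * f3 k + αΦ * cΦ * f4 k + αΦ ^ 2 * f5 k)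
        + R k := by
    filter_upwards [ae_mem_cube_and_Dhat_lt_one (d := d) (by omega)] with k hk
    have h := hKB k hk.1 hk.2
    have hG := (lapAtomsAt d cΦ αΦ cF αF RΦ RF k).G_eq_split h.Q_pos.ne' h.Cden_pos.ne'
    simp only [lapAtomsAt_cΦ, lapAtomsAt_αΦ, lapAtomsAt_D] at hG
    simp only [hf1, hf2, hf3, hf4, hf5, hR, LapAtoms.H1, lapAtomsAt_αF, lapAtomsAt_cΦ, lapAtomsAt_αΦ, lapAtomsAt_D]
    linear_combination ((αF * (cΦ + αΦ * Dhat d k) * (lapAtomsAt d cΦ αΦ cF αF RΦ RF k).Cstar + αΦ) *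
      (lapAtomsAt d cΦ αΦ cF αF RΦ RF k).Cstar * (lapAtomsAt d cΦ αΦ cF αF RΦ RF k).Mstar *
      (Dhat d k ^ l * DhatSym d x k)) * hG
  -- the five slot bounds
  have b1 : |αF * ((∫ k, f1 k ∂P d) / (2 * π) ^ d)| ≤ τ.IM 1 l x / r.afmin := by
    have h := H1SlotD80.abs_alpha_mul_slot_le (dR := (d : ℝ)) 1 hd0 hα1 hαF hαFup (srwJ_nonneg (n := 1) (by omega) l x)
      (srwI_nonneg (1 + 3) (by omega) l x) (srwIShift2_nonneg (p := 1 + 3) (by omega) l x) (hAlt 1 l x le_rfl)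
      (hXup 1 l x le_rfl) (hXlo 1 l x le_rfl)
    simp only [pow_one, Nat.reduceAdd, Nat.cast_one] at h
    exact h
  have b2 : |αF * ((∫ k, f2 k ∂P d) / (2 * π) ^ d)| ≤ τ.IM 1 (l + 1) x / r.afmin := by
    have h := H1SlotD80.abs_alpha_mul_slot_le (dR := (d : ℝ)) 1 hd0 hα1 hαF hαFup
      (srwJ_nonneg (n := 1) (by omega) (l + 1) x) (srwI_nonneg (1 + 3) (by omega) (l + 1) x)
      (srwIShift2_nonneg (p := 1 + 3) (by omega) (l + 1) x) (hAlt 1 (l + 1) x le_rfl)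
      (hXup 1 (l + 1) x le_rfl) (hXlo 1 (l + 1) x le_rfl)
    simp only [pow_one, Nat.reduceAdd, Nat.cast_one] at h
    exact h
  have b3 : |αF * ((∫ k, f3 k ∂P d) / (2 * π) ^ d)| ≤ τ.IM 1 (l + 2) x / r.afmin := by
    have h := H1SlotD80.abs_alpha_mul_slot_le (dR := (d : ℝ)) 1 hd0 hα1 hαF hαFup
      (srwJ_nonneg (n := 1) (by omega) (l + 2) x) (srwI_nonneg (1 + 3) (by omega) (l + 2) x)
      (srwIShift2_nonneg (p := 1 + 3) (by omega) (l + 2) x) (hAlt 1 (l + 2) x le_rfl)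
      (hXup 1 (l + 2) x le_rfl) (hXlo 1 (l + 2) x le_rfl)
    simp only [pow_one, Nat.reduceAdd, Nat.cast_one] at h
    exact h
  have b4 : |(∫ k, f4 k ∂P d) / (2 * π) ^ d| ≤ τ.IM 0 l x / r.afmin := by
    have h := H1SlotD80.abs_slot_le (dR := (d : ℝ)) 0 hd0 hα1 hαF hαFup (srwJ_nonneg (n := 0) (by omega) l x)
      (srwI_nonneg (0 + 3) (by omega) l x) (srwIShift2_nonneg (p := 0 + 3) (by omega) l x) (hAlt 0 l x (by norm_num))
      (hXup 0 l x (by norm_num)) (hXlo 0 l x (by norm_num))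
    simp only [zero_add, pow_one, Nat.cast_zero] at h
    exact h
  have b5 : |(∫ k, f5 k ∂P d) / (2 * π) ^ d| ≤ τ.IM 0 (l + 1) x / r.afmin := by
    have h := H1SlotD80.abs_slot_le (dR := (d : ℝ)) 0 hd0 hα1 hαF hαFup (srwJ_nonneg (n := 0) (by omega) (l + 1) x)
      (srwI_nonneg (0 + 3) (by omega) (l + 1) x) (srwIShift2_nonneg (p := 0 + 3) (by omega) (l + 1) x)
      (hAlt 0 (l + 1) x (by norm_num)) (hXup 0 (l + 1) x (by norm_num)) (hXlo 0 (l + 1) x (by norm_num))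
    simp only [zero_add, pow_one, Nat.cast_zero] at h
    exact h
  -- the main part
  have hmainB : |cΦ ^ 2 * αF * ((∫ k, f1 k ∂P d) / (2 * π) ^ d) + 2 * (cΦ * αΦ) * αF * ((∫ k, f2 k ∂P d) / (2 * π) ^ d)
      + αΦ ^ 2 * αF * ((∫ k, f3 k ∂P d) / (2 * π) ^ d) + αΦ * cΦ * ((∫ k, f4 k ∂P d) / (2 * π) ^ d)
      + αΦ ^ 2 * ((∫ k, f5 k ∂P d) / (2 * π) ^ d)|
      ≤ r.cp ^ 2 / r.afmin * τ.IM 1 l x + r.cp * r.ap / r.afmin * τ.IM 0 l x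
        + 2 * (r.ap * r.cp / r.afmin) * τ.IM 1 (l + 1) x + r.ap ^ 2 / r.afmin * τ.IM 0 (l + 1) x
        + r.ap ^ 2 / r.afmin * τ.IM 1 (l + 2) x := by
    set Y1 := (∫ k, f1 k ∂P d) / (2 * π) ^ d
    set Y2 := (∫ k, f2 k ∂P d) / (2 * π) ^ d
    set Y3 := (∫ k, f3 k ∂P d) / (2 * π) ^ d
    set Y4 := (∫ k, f4 k ∂P d) / (2 * π) ^ d
    set Y5 := (∫ k, f5 k ∂P d) / (2 * π) ^ d
    have e : cΦ ^ 2 * αF * Y1 + 2 * (cΦ * αΦ) * αF * Y2 + αΦ ^ 2 * αF * Y3 + αΦ * cΦ * Y4 + αΦ ^ 2 * Y5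
        = cΦ ^ 2 * (αF * Y1) + 2 * (cΦ * αΦ) * (αF * Y2) + αΦ ^ 2 * (αF * Y3) + αΦ * cΦ * Y4 + αΦ ^ 2 * Y5 := by
      ring
    rw [e]
    have hcΦ2 : cΦ ^ 2 ≤ r.cp ^ 2 := pow_le_pow_left₀ hcΦ0 hcΦ 2
    have hαΦ2 : |αΦ| ^ 2 ≤ r.ap ^ 2 := pow_le_pow_left₀ (abs_nonneg _) hαΦ 2
    have i1 : |cΦ ^ 2 * (αF * Y1)| ≤ r.cp ^ 2 * (τ.IM 1 l x / r.afmin) := by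
      rw [abs_mul, abs_pow, abs_of_nonneg hcΦ0]
      exact mul_le_mul hcΦ2 b1 (abs_nonneg _) (pow_nonneg hcp 2)
    have i2 : |2 * (cΦ * αΦ) * (αF * Y2)| ≤ 2 * (r.cp * r.ap) * (τ.IM 1 (l + 1) x / r.afmin) := by
      rw [abs_mul]
      have h2 : |2 * (cΦ * αΦ)| ≤ 2 * (r.cp * r.ap) := by
        rw [abs_mul, abs_mul, abs_two, abs_of_nonneg hcΦ0]
        exact mul_le_mul_of_nonneg_left (mul_le_mul hcΦ hαΦ (abs_nonneg _) hcp) two_pos.le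
      exact mul_le_mul h2 b2 (abs_nonneg _) (by positivity)
    have i3 : |αΦ ^ 2 * (αF * Y3)| ≤ r.ap ^ 2 * (τ.IM 1 (l + 2) x / r.afmin) := by
      rw [abs_mul, abs_pow]
      exact mul_le_mul hαΦ2 b3 (abs_nonneg _) (pow_nonneg hap 2)
    have i4 : |αΦ * cΦ * Y4| ≤ r.ap * r.cp * (τ.IM 0 l x / r.afmin) := by
      rw [abs_mul, abs_mul, abs_of_nonneg hcΦ0]
      exact mul_le_mul (mul_le_mul hαΦ hcΦ hcΦ0 hap) b4 (abs_nonneg _) (mul_nonneg hap hcp)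
    have i5 : |αΦ ^ 2 * Y5| ≤ r.ap ^ 2 * (τ.IM 0 (l + 1) x / r.afmin) := by
      rw [abs_mul, abs_pow]
      exact mul_le_mul hαΦ2 b5 (abs_nonneg _) (pow_nonneg hap 2)
    have t2 : |cΦ ^ 2 * (αF * Y1) + 2 * (cΦ * αΦ) * (αF * Y2)|
        ≤ |cΦ ^ 2 * (αF * Y1)| + |2 * (cΦ * αΦ) * (αF * Y2)| := abs_add_le _ _
    have t3 : |cΦ ^ 2 * (αF * Y1) + 2 * (cΦ * αΦ) * (αF * Y2) + αΦ ^ 2 * (αF * Y3)|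
        ≤ |cΦ ^ 2 * (αF * Y1)| + |2 * (cΦ * αΦ) * (αF * Y2)| + |αΦ ^ 2 * (αF * Y3)| :=
      (abs_add_le _ _).trans (add_le_add t2 le_rfl)
    have t4 : |cΦ ^ 2 * (αF * Y1) + 2 * (cΦ * αΦ) * (αF * Y2) + αΦ ^ 2 * (αF * Y3) + αΦ * cΦ * Y4|
        ≤ |cΦ ^ 2 * (αF * Y1)| + |2 * (cΦ * αΦ) * (αF * Y2)| + |αΦ ^ 2 * (αF * Y3)| + |αΦ * cΦ * Y4| :=
      (abs_add_le _ _).trans (add_le_add t3 le_rfl)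
    calc |cΦ ^ 2 * (αF * Y1) + 2 * (cΦ * αΦ) * (αF * Y2) + αΦ ^ 2 * (αF * Y3) + αΦ * cΦ * Y4 + αΦ ^ 2 * Y5|
        ≤ |cΦ ^ 2 * (αF * Y1)| + |2 * (cΦ * αΦ) * (αF * Y2)| + |αΦ ^ 2 * (αF * Y3)| + |αΦ * cΦ * Y4|
          + |αΦ ^ 2 * Y5| := (abs_add_le _ _).trans (add_le_add t4 le_rfl)
      _ ≤ r.cp ^ 2 * (τ.IM 1 l x / r.afmin) + 2 * (r.cp * r.ap) * (τ.IM 1 (l + 1) x / r.afmin)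
          + r.ap ^ 2 * (τ.IM 1 (l + 2) x / r.afmin) + r.ap * r.cp * (τ.IM 0 l x / r.afmin)
          + r.ap ^ 2 * (τ.IM 0 (l + 1) x / r.afmin) :=
          add_le_add (add_le_add (add_le_add (add_le_add i1 i2) i3) i4) i5
      _ = _ := by ring
  -- the (3.65)-remainder part through the `T`-slots: pointwise, then integrated
  have hptR : ∀ k ∈ cube d, Dhat d k < 1 → |R k| ≤
      (r.bRp + r.bRfDelta * r.Gamma2dash) / r.afmin ^ 2 * r.cp *
          ((|Dhat d k| ^ l * |DhatSym d x k|) * (Chat d 1 k ^ 3 * (|Dhat d k| + 2 / r.afmin * (Dsin d k * Chat d 1 k))))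
        + (r.bRp + r.bRfDelta * r.Gamma2dash) / r.afmin ^ 2 * r.ap *
          ((|Dhat d k| ^ (l + 1) * |DhatSym d x k|) * (Chat d 1 k ^ 3 * (|Dhat d k| + 2 / r.afmin * (Dsin d k * Chat d 1 k))))
        + (r.bRp + r.bRfDelta * r.Gamma2dash) / r.afmin ^ 2 * r.ap *
          ((|Dhat d k| ^ l * |DhatSym d x k|) * (Chat d 1 k ^ 2 * (|Dhat d k| + 2 / r.afmin * (Dsin d k * Chat d 1 k)))) := by
    intro k hk hDk
    have h := hKB k hk hDk
    have hC : 1 / (1 - (lapAtomsAt d cΦ αΦ cF αF RΦ RF k).D) = Chat d 1 k := by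
      rw [lapAtomsAt_D, Chat, one_mul]
    have hb := h.abs_H1_mul_rem_le
    rw [hC, lapAtomsAt_D, lapAtomsAt_Dsin] at hb
    have hw : 0 ≤ |Dhat d k| ^ l * |DhatSym d x k| := by positivity
    simp only [hR]
    rw [abs_mul _ (Dhat d k ^ l * DhatSym d x k), abs_mul (Dhat d k ^ l), abs_pow]
    calc _ ≤ ((r.cp + r.ap * |Dhat d k|) * Chat d 1 k + r.ap) * (Chat d 1 k / r.afmin) *
            (|Dhat d k| + 2 * Dsin d k * (Chat d 1 k / r.afmin)) *
            ((r.bRp + r.bRfDelta * r.Gamma2dash) / r.afmin * Chat d 1 k) * (|Dhat d k| ^ l * |DhatSym d x k|) :=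
          mul_le_mul_of_nonneg_right hb hw
      _ = _ := by ring
  have hRB : |(∫ k, R k ∂P d) / (2 * π) ^ d| ≤ (r.bRp + r.bRfDelta * r.Gamma2dash) / r.afmin ^ 2 *
      (r.cp * τ.T 3 l x + r.ap * τ.T 3 (l + 1) x + r.ap * τ.T 2 l x) := by
    have hπ : (0 : ℝ) < (2 * π) ^ d := by positivity
    rw [abs_div, abs_of_pos hπ]
    refine (div_le_div_of_nonneg_right (abs_integral_le_integral_abs) hπ.le).trans ?_
    have h3 := integral_div_le_of_le_three_monomials (d := d) (by omega) (fun k => abs_nonneg (R k))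
      (integrable_srwTS_integrand (m := 3) (by omega) r.afmin l x)
      (integrable_srwTS_integrand (m := 3) (by omega) r.afmin (l + 1) x)
      (integrable_srwTS_integrand (m := 2) (by omega) r.afmin l x) hptR
    rw [integral_srwTS_integrand_eq (m := 3) (by omega) r.afmin l x,
      integral_srwTS_integrand_eq (m := 3) (by omega) r.afmin (l + 1) x,
      integral_srwTS_integrand_eq (m := 2) (by omega) r.afmin l x] at h3
    refine h3.trans ?_
    have hT1 : srwTS d r.afmin 3 l x ≤ τ.T 3 l x := hT 3 l x
    have hT2 : srwTS d r.afmin 3 (l + 1) x ≤ τ.T 3 (l + 1) x := hT 3 (l + 1) x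
    have hT3 : srwTS d r.afmin 2 l x ≤ τ.T 2 l x := hT 2 l x
    have hc1 : 0 ≤ (r.bRp + r.bRfDelta * r.Gamma2dash) / r.afmin ^ 2 * r.cp := by positivity
    have hc2 : 0 ≤ (r.bRp + r.bRfDelta * r.Gamma2dash) / r.afmin ^ 2 * r.ap := by positivity
    calc _ ≤ (r.bRp + r.bRfDelta * r.Gamma2dash) / r.afmin ^ 2 * r.cp * τ.T 3 l x
          + (r.bRp + r.bRfDelta * r.Gamma2dash) / r.afmin ^ 2 * r.ap * τ.T 3 (l + 1) x
          + (r.bRp + r.bRfDelta * r.Gamma2dash) / r.afmin ^ 2 * r.ap * τ.T 2 l x :=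
          add_le_add_three (mul_le_mul_of_nonneg_left hT1 hc1) (mul_le_mul_of_nonneg_left hT2 hc2)
            (mul_le_mul_of_nonneg_left hT3 hc2)
      _ = _ := by ring
  -- assemble
  have hbd : F3Bounds.boundH1 τ 1 l x r
      = (r.cp ^ 2 / r.afmin * τ.IM 1 l x + r.cp * r.ap / r.afmin * τ.IM 0 l x
          + 2 * (r.ap * r.cp / r.afmin) * τ.IM 1 (l + 1) x + r.ap ^ 2 / r.afmin * τ.IM 0 (l + 1) x
          + r.ap ^ 2 / r.afmin * τ.IM 1 (l + 2) x)
        + (r.bRp + r.bRfDelta * r.Gamma2dash) / r.afmin ^ 2 *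
          (r.cp * τ.T 3 l x + r.ap * τ.T 3 (l + 1) x + r.ap * τ.T 2 l x) := rfl
  by_cases hint : Integrable (fun k => (lapAtomsAt d cΦ αΦ cF αF RΦ RF k).H1 *
      (lapAtomsAt d cΦ αΦ cF αF RΦ RF k).G ^ 1 * Dhat d k ^ l * DhatSym d x k) (P d)
  · have hRi : Integrable R (P d) := by
      refine (hint.sub hmainI).congr ?_
      filter_upwards [hae] with k hk
      rw [Pi.sub_apply, hk]
      ring
    have hspl : (∫ k, (lapAtomsAt d cΦ αΦ cF αF RΦ RF k).H1 * (lapAtomsAt d cΦ αΦ cF αF RΦ RF k).G ^ 1 *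
          Dhat d k ^ l * DhatSym d x k ∂P d) / (2 * π) ^ d
        = (cΦ ^ 2 * αF * ((∫ k, f1 k ∂P d) / (2 * π) ^ d) + 2 * (cΦ * αΦ) * αF * ((∫ k, f2 k ∂P d) / (2 * π) ^ d)
            + αΦ ^ 2 * αF * ((∫ k, f3 k ∂P d) / (2 * π) ^ d) + αΦ * cΦ * ((∫ k, f4 k ∂P d) / (2 * π) ^ d)
            + αΦ ^ 2 * ((∫ k, f5 k ∂P d) / (2 * π) ^ d))
          + (∫ k, R k ∂P d) / (2 * π) ^ d := by
      rw [integral_congr_ae hae, integral_add hmainI hRi, add_div,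
        integral_div_five_terms _ _ _ _ _ hf1i hf2i hf3i hf4i hf5i]
    rw [hspl, hbd]
    exact (abs_add_le _ _).trans (add_le_add hmainB hRB)
  · rw [integral_undef hint, zero_div, abs_zero, hbd]
    exact add_nonneg ((abs_nonneg _).trans hmainB) ((abs_nonneg _).trans hRB)

/-! ## The x-space bounds discharged (`NobleH1XSpace`) -/

/-- **[NoBLE17] §3.3.5 Step 1, `n = 0`, per-key alternative, x-space bounds discharged**: for `2·3+1 ≤ d`, `KeyBounds r` on the cube
off `{D̂ = 1}`, the strict window, `1 ≤ α̲_F` and a table with `SlotAlt` at every key `(0, j, y)` and (H-IM1), (H-low1):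
`|∫ Ĥ₁ Ĝ⁰ D̂^l D̂^{(x)} dP/(2π)^d| ≤ F3Bounds.boundH1 τ 0 l x r` — no global (H-SC)/(H-low).
`NobleH1StepXSpace.abs_integral_H1_diagram_le_boundH1_zero_of_tables` is the case "left disjunct at every key".
[cite: FitznerVanDerHofstad2016NoBLE, §3.3.5 (3.58)–(3.63), (3.71) pp. 1074–1077; FitznerVanDerHofstad2017, notebook General.nb In[2] BoundH[1]] -/
theorem abs_integral_H1_diagram_le_boundH1_zero_of_alt_tables (hd : 2 * 3 + 1 ≤ d)
    (hKB : ∀ k ∈ cube d, Dhat d k < 1 → (lapAtomsAt d cΦ αΦ cF αF RΦ RF k).KeyBounds r)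
    (hc0 : cF + αF + cosFT RF 0 < 1) (hα1 : 1 ≤ r.afmin) (τ : F3Bounds.Tables (Fin d → ℤ))
    (hAlt : ∀ j y, H1SlotD80.SlotAlt d r.afmin r.afmax (srwJ d 2 j y) (srwI d 3 j y) (srwIShift2 d 3 j y) (τ.IM 0 j y))
    (hIM1 : ∀ j y, srwI d 1 (j + 1) y + srwIShift2 d 2 j y / (2 * (d : ℝ) ^ 2 * r.afmin) ≤ τ.IM (-1) j y)
    (hLow1 : ∀ j y, srwI d 2 j y ≤ d * r.afmin * τ.IM (-1) j y) (l : ℕ) (x : Fin d → ℤ) :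
    |(∫ k, (lapAtomsAt d cΦ αΦ cF αF RΦ RF k).H1 * (lapAtomsAt d cΦ αΦ cF αF RΦ RF k).G ^ 0 *
        Dhat d k ^ l * DhatSym d x k ∂P d) / (2 * π) ^ d| ≤ F3Bounds.boundH1 τ 0 l x r := by
  have hα : 1 ≤ αF := hα1.trans (keyBounds_consts (by omega) hKB).1
  exact abs_integral_H1_diagram_le_boundH1_zero_of_alt hd hKB hc0 hα1 τ
    (fun j y => integral_Cstar_pow_Mstar_le (cΦ := cΦ) (αΦ := αΦ) (RΦ := RΦ) (m := 0) (by omega) hc0 hα j y)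
    (fun j y => neg_le_integral_Cstar_pow_Mstar (cΦ := cΦ) (αΦ := αΦ) (RΦ := RΦ) (m := 0) (by omega) hc0 hα j y)
    hAlt hIM1 hLow1 l x

/-- **[NoBLE17] §3.3.5 Step 1, `n = 1`, per-key alternative, x-space bounds discharged**: for `2·4+1 ≤ d`, `KeyBounds r` on the cube
off `{D̂ = 1}`, the strict window, `1 ≤ α̲_F` and a table with `SlotAlt` at every key `(m, j, y)`, `m ≤ 1`, and (H-T):
`|∫ Ĥ₁ Ĝ¹ D̂^l D̂^{(x)} dP/(2π)^d| ≤ F3Bounds.boundH1 τ 1 l x r` — no global (H-SC)/(H-low).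
`NobleH1StepXSpace.abs_integral_H1_diagram_le_boundH1_one_of_tables` is the case "left disjunct at every key".
[cite: FitznerVanDerHofstad2016NoBLE, §3.3.5 (3.58)–(3.66), (3.71) pp. 1074–1077; FitznerVanDerHofstad2017, notebook General.nb In[2] BoundH[1]] -/
theorem abs_integral_H1_diagram_le_boundH1_one_of_alt_tables (hd : 2 * 4 + 1 ≤ d)
    (hKB : ∀ k ∈ cube d, Dhat d k < 1 → (lapAtomsAt d cΦ αΦ cF αF RΦ RF k).KeyBounds r)
    (hc0 : cF + αF + cosFT RF 0 < 1) (hα1 : 1 ≤ r.afmin) (τ : F3Bounds.Tables (Fin d → ℤ))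
    (hAlt : ∀ (m j : ℕ) (y : Fin d → ℤ), m ≤ 1 → H1SlotD80.SlotAlt d r.afmin r.afmax (srwJ d (m + 2) j y)
      (srwI d (m + 3) j y) (srwIShift2 d (m + 3) j y) (τ.IM m j y))
    (hT : ∀ (m j : ℕ) (y : Fin d → ℤ), srwTS d r.afmin m j y ≤ τ.T m j y) (l : ℕ) (x : Fin d → ℤ) :
    |(∫ k, (lapAtomsAt d cΦ αΦ cF αF RΦ RF k).H1 * (lapAtomsAt d cΦ αΦ cF αF RΦ RF k).G ^ 1 *
        Dhat d k ^ l * DhatSym d x k ∂P d) / (2 * π) ^ d| ≤ F3Bounds.boundH1 τ 1 l x r := by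
  have hα : 1 ≤ αF := hα1.trans (keyBounds_consts (by omega) hKB).1
  exact abs_integral_H1_diagram_le_boundH1_one_of_alt hd hKB hc0 hα1 τ
    (fun m j y hm => integral_Cstar_pow_Mstar_le (cΦ := cΦ) (αΦ := αΦ) (RΦ := RΦ) (m := m) (by omega) hc0 hα j y)
    (fun m j y hm => neg_le_integral_Cstar_pow_Mstar (cΦ := cΦ) (αΦ := αΦ) (RΦ := RΦ) (m := m) (by omega) hc0 hα j y)
    hAlt hT l x

/-! ## The printed hypotheses recover `NobleH1Step` (the alternative is a generalisation) -/

/-- The global printed triple (H-IM), (H-SC), (H-low) of `NobleH1Step` gives `SlotAlt` at every key (left disjunct), so the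
`_of_alt` theorems contain `NobleH1Step.abs_integral_H1_diagram_le_boundH1_one` / `NobleH1StepXSpace.…_one_of_tables`.
[cite: FitznerVanDerHofstad2016NoBLE, §3.3.5 (3.62) p. 1076] -/
theorem slotAlt_of_printed_tables (τ : F3Bounds.Tables (Fin d → ℤ))
    (hIM : ∀ (m j : ℕ) (y : Fin d → ℤ), m ≤ 1 → srwJ d (m + 2) j y ≤ τ.IM m j y)
    (hSC : ∀ (m j : ℕ) (y : Fin d → ℤ), m ≤ 1 → srwI d (m + 3) j y ≤ d * r.afmin * τ.IM m j y)
    (hLow : ∀ (m j : ℕ) (y : Fin d → ℤ), m ≤ 1 → (r.afmax - 1) * srwIShift2 d (m + 3) j y ≤ 2 * (d : ℝ) ^ 2 * τ.IM m j y)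
    (m j : ℕ) (y : Fin d → ℤ) (hm : m ≤ 1) :
    H1SlotD80.SlotAlt d r.afmin r.afmax (srwJ d (m + 2) j y) (srwI d (m + 3) j y) (srwIShift2 d (m + 3) j y) (τ.IM m j y) :=
  H1SlotD80.slotAlt_of_printed (hIM m j y hm) (hSC m j y hm) (hLow m j y hm)

end StepOneD80

end Literature.Probability.FitznerVanDerHofstad2017

end
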